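import Summits.BirchSwinnertonDyer.BirchSwinnertonDyer.Theorems.ErratumRoadFiveEulerHalfGenusFrameKolyvaginCurrency
import Summits.BirchSwinnertonDyer.BirchSwinnertonDyer.Theorems.ErratumRoadFiveEulerHalfGenusFamilyH47OrdersGuard
import Summits.BirchSwinnertonDyer.BirchSwinnertonDyer.Theorems.ErratumRoadFiveEulerHalfPOnlyMultPotMultTwinAtFiveGenusKolyvaginPointsRC
import HarnessLib

/-!
# ErratumRoadFive ∕ EulerHalf ∕ genus line — (b2b-κ) brick: clause (7) `ord loc_λ c_k(cℓ) = ord loc_λ c_k(c)` on a served frame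
# (helper, `--supports 23444`)

Cell bsd-stepL, prover seat `bsd-stepL-imc-p1` g42; plan `HOME/imc-p1/g42/B2BK-ASSEMBLY-PLAN-imc-p1-g42.md` §3 (7).

WHAT.  `addOrderOf_localization_kolyvaginClass_eq_of_frameProfile` — [J] Prop. 4.7 ⟸ [McC] Prop. 4.4 for the genus family on a served
frame: for ANY family data `d` at a square-free Zhang–Kolyvagin level `c` and `d′` at level `cℓ` (`ℓ ∤ c` Zhang–Kolyvagin) on the labelled
family `ys` (`d.y = ys c`, `d′.y = ys (cℓ)`; labels `LabelsAt W (2N_W) …`), `1 ≤ k ≤ M(c), M(ℓ)`, and a place `λ ∋ ℓ`: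
`ord loc_λ c_k(d′) = ord loc_λ c_k(d)`.  It is corner3-p2's producer at the label guard `2N_W`
(`ShimuraWalk.addOrderOf_localization_kolyvaginClass_familyData_eq_of_labelsGuard`, p729517) fed by adapter B (p729808:
Gross currency at depth `k`, the guard), `htor` from `ρ̄` onto (`RingClassNoTorsion`), `d_K < −4` from the genus shape.

HONEST FRAMING: helper; conditional on a parametrisation datum `DtW` of `W`; no crux and no stub is closed; BSD is proved for no curve.
[cite: McCallumLMS1991, §4 Prop. 4.4, Cor. 4.5] [cite: Jetchev2008, Prop. 4.7, Prop. 4.10 (ii)] [cite: GrossLMS1991, Prop. 3.7 (2), §4 (4.4)]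
presearch: in-tree only; no new literature.
-/

set_option autoImplicit false
-- D-0017: single-problem summit, so `Summit.BirchSwinnertonDyer.BirchSwinnertonDyer.…` repeats a namespace BY DESIGN.
set_option linter.dupNamespace false

noncomputable section

open scoped Classical
open WeierstrassCurve NumberField Field IsDedekindDomain Literature.NumberTheory.EllipticCurves
  Literature.NumberTheory.EllipticCurves.ModularForms Literature.NumberTheory.GaloisRepresentations
  Summit.BirchSwinnertonDyer.Rank1Residual Summit.BirchSwinnertonDyer.Rank1Residual.X11b
  Summit.BirchSwinnertonDyer.Rank1Residual.JET

namespace Summit.BirchSwinnertonDyer.BirchSwinnertonDyer.Theorems.GenusLine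

variable {W A : WeierstrassCurve ℚ} {p q : ℕ} {K : Type} [Field K] [NumberField K]

/-- The Zhang level index is multiplicative-min: `k ≤ M(c)` and `k ≤ M(ℓ)` give `k ≤ M(cℓ)`. [cite: WZhang2014, Notations (xii)] -/
theorem natCast_le_levelIndex_mul [W.IsGloballyMinimal] {k c ℓ : ℕ} (hc : c ≠ 0) (hℓ : ℓ.Prime)
    (hkc : (k : ℕ∞) ≤ Zhang2014.levelIndex W p c) (hkℓ : k ≤ Zhang2014.kolyvaginIndex W p ℓ) :
    (k : ℕ∞) ≤ Zhang2014.levelIndex W p (c * ℓ) := by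
  rw [Zhang2014.natCast_le_levelIndex_iff] at hkc ⊢
  intro r hr
  rw [Nat.primeFactors_mul hc hℓ.ne_zero, Finset.mem_union] at hr
  rcases hr with h | h
  · exact hkc r h
  · rw [hℓ.primeFactors, Finset.mem_singleton] at h
    subst h
    exact hkℓ

/-- **Clause (7) of `GenusClassDataSupply` on a served frame** — see the module docstring.
[cite: McCallumLMS1991, §4 Prop. 4.4] [cite: Jetchev2008, Prop. 4.7] [cite: GrossLMS1991, Prop. 3.7 (2), §4 (4.4)] -/
theorem addOrderOf_localization_kolyvaginClass_eq_of_frameProfile [W.IsElliptic] [W.IsGloballyMinimal] [A.IsElliptic]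
    [Fact p.Prime] [Fact q.Prime] [NeZero (W.conductorNorm ℤ)]
    (S : GenusHeegnerSettingRC W A p q K) (hprof : FrameProfile W A p q K)
    (DtW : ModularParametrizationData W (W.conductorNorm ℤ)) [∀ j : ℕ, NumberField (ringClassField K S.ιc j)]
    {yK : (W.baseChange K).toAffine.Point}
    {ys : (m : ℕ) → (W.baseChange (ringClassField K S.ιc m)).toAffine.Point} {ε₀ : ℤ}
    (hL : ShimuraWalk.LabelsAt W (2 * W.conductorNorm ℤ) K S.ιc yK ys ε₀)
    {k c ℓ : ℕ} (hk : 1 ≤ k) (hc : Squarefree c)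
    (hKolc : ∀ r ∈ c.primeFactors, Zhang2014.IsKolyvaginPrime (W.conductorNorm ℤ) W K p r)
    (hkc : (k : ℕ∞) ≤ Zhang2014.levelIndex W p c)
    (hℓ : Zhang2014.IsKolyvaginPrime (W.conductorNorm ℤ) W K p ℓ) (hkℓ : k ≤ Zhang2014.kolyvaginIndex W p ℓ)
    (hℓc : ℓ ∉ c.primeFactors)
    (d : KolyvaginFamilyData W K S.ιc c) (d' : KolyvaginFamilyData W K S.ιc (c * ℓ))
    (hdy : d.y = ys c) (hd'y : d'.y = ys (c * ℓ))
    (v : HeightOneSpectrum (𝓞 K)) (hv : (ℓ : 𝓞 K) ∈ v.asIdeal) :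
    addOrderOf (galoisCohomology.localization ((W.baseChange K).torsionGaloisModule ((p ^ k : ℕ) : ℤ)) (Sum.inr v) 1
        (d'.kolyvaginClass (Fact.out : p.Prime) k)) =
      addOrderOf (galoisCohomology.localization ((W.baseChange K).torsionGaloisModule ((p ^ k : ℕ) : ℤ)) (Sum.inr v) 1
        (d.kolyvaginClass (Fact.out : p.Prime) k)) := by
  have hp : p.Prime := Fact.out
  have hK : IsImaginaryQuadratic K := hprof.quad
  have hp2 : p ≠ 2 := p_ne_two_of_frameProfile hprof
  have hD : NumberField.discr K < -4 := GenusKolyvaginRC.discr_lt_neg_four_of_genus hK S.hd₁ S.hd₂ S.hd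
  have hℓp : ℓ.Prime := hℓ.1
  have hℓndvd : ¬ ℓ ∣ c := fun h ↦ hℓc (Nat.mem_primeFactors.mpr ⟨hℓp, h, hc.ne_zero⟩)
  -- Zhang–Kolyvagin at level `cℓ`, Gross currency at depth `k`, the guard `2N_W`
  have hKolcℓ : ∀ r ∈ (c * ℓ).primeFactors, Zhang2014.IsKolyvaginPrime (W.conductorNorm ℤ) W K p r := by
    intro r hr
    rw [Nat.primeFactors_mul hc.ne_zero hℓp.ne_zero, Finset.mem_union] at hr
    rcases hr with h | h
    · exact hKolc r h
    · rw [hℓp.primeFactors, Finset.mem_singleton] at h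
      subst h
      exact hℓ
  have hKolG := grossKolyvagin_level_of_frameProfile hprof hk hKolcℓ
    (natCast_le_levelIndex_mul hc.ne_zero hℓp hkc hkℓ)
  have hKolN' := not_dvd_two_mul_level_of_frameProfile hprof hKolcℓ
  -- no `p`-power torsion in `E(K[m])`
  have htor : ∀ m : ℕ, m ≠ 0 → ¬ p ∣ m →
      ∀ (n' : ℕ) (a : (W.baseChange (ringClassField K S.ιc m)).toAffine.Point), ((p ^ n' : ℕ) : ℤ) • a = 0 → a = 0 :=
    fun m hm _ n' a ha ↦ RingClassNoTorsion.eq_zero_of_zsmul_pow_eq_zero_ringClassField W hK S.ιc hm hp hp2 hprof.surj n' a ha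
  exact ShimuraWalk.addOrderOf_localization_kolyvaginClass_familyData_eq_of_labelsGuard hK hD S.ιc rfl hp2 DtW htor ys hL k c
    (c * ℓ) d d' ℓ hdy hd'y hc hKolG hℓp hℓndvd rfl hKolN' v hv

end Summit.BirchSwinnertonDyer.BirchSwinnertonDyer.Theorems.GenusLine

end
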